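import Mathlib.CategoryTheory.Products.Basic
import Literature.IUT.HodgeTheaters.ThetaHodgeTheatersCor56iSub
import HarnessLib

/-!
# [IUTchI] Corollary 5.6 (i), sub-DAG row L03 is INDEPENDENT of Cor 5.3 (ii), (iv) over the kit (proof-only witness)

S. Mochizuki, *Inter-universal Teichmüller theory I*, kurims manuscript (May 2020), §5, Corollary 5.6 (i), proof
p. 154 l. 8–24 ([IUTchI] Cor 5.6 (i) p.154) [claim: Mochizuki2012, status: disputed].  Proof-only companion
(abc-iut cell, seat abc-iut-w5-d217; 0 definitions) of the sub-DAG file `ThetaHodgeTheatersCor56iSub.lean` (p414027,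
plan/L5/SUBDAG-IUTchI-Cor56i.md).  That file proved `cor56iKit_iff_rlfDetermined`: over any kit satisfying row L02
(`ThToFBijOnGood`), Cor 5.3 (ii) (`IsomFtoDBijective`) and Cor 5.3 (iv) (`AutTemperedBijective`), Cor 5.6 (i)
(`Cor56iKit`) holds iff row L03 (`RlfDetermined`: the global realified datum `†𝔉^⊩_mod` of a Θ-Hodge theater carries no
isomorphism data beyond the local data) holds.

HERE: row L03 — and hence Cor 5.6 (i) — is NOT a consequence of L02 + Cor 5.3 (ii) + Cor 5.3 (iv) over abc-iut-L5-t4's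
kit `PMBaseKit.FKit`: `exists_fkit_not_rlfDetermined` exhibits a kit (over the toy base kit `toyKit`, `MultKit.toy`)
in which all functors `thToF v`, `toD v`, `toFm v` are identities — so L02, Cor 5.3 (ii), (iv) hold — but whose
category of globally realified data `(‡𝒞^⊩, Prime ⥲ 𝕍, ‡𝔉^⊢, {‡ρ_v})` carries an extra factor INVISIBLE to the
`ℱ^⊢`-components `rlfFm v`; an automorphism of that factor (`-1 ∈ ℤˣ = Aut(𝒟_v)` of the toy collage category) is a
second global component compatible with the identity local isomorphisms, so `RlfDetermined` and `Cor56iKit` FAIL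
(`Isom(†ℋ𝒯^Θ, †ℋ𝒯^Θ) → Isom(†𝔇_>, †𝔇_>)` is not injective).  Consequently the printed sentence "this global data may be
obtained by applying the functorial algorithm `‡𝔉 ↦ ‡𝔉^⊩` … to the associated `ℱ`-prime-strips" (p. 154 l. 16–20) is
LOAD-BEARING content of the proof of Cor 5.6 (i), not bookkeeping: it is exactly what the interface does not supply
(cf. `cor56iKit_of_laws` in `ThetaHodgeTheatersCor56iSubProofs.lean` for the laws that do supply it).  Pattern of
abc-iut-L5-d4's `exists_fkit_not_isomFtoDBijective` (FPrimeStripsRigidity).  No side is taken on [IUTchIII] Cor 3.12;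
typed ≠ proved; the witness kit is NOT the arithmetic model.
-/

namespace Literature.IUT.HodgeTheaters

open CategoryTheory

namespace PMBaseKit

namespace FKit

/-- **INDEPENDENCE of row L03 / of Cor 5.6 (i) over the kit.**  For every prime `l ≠ 2` there is an `ℱ`-kit over
the toy base kit in which row L02 (`ThToFBijOnGood`), Cor 5.3 (ii) (`IsomFtoDBijective`) and Cor 5.3 (iv)
(`AutTemperedBijective`) HOLD while row L03 (`RlfDetermined`) and Cor 5.6 (i) (`Cor56iKit`) FAIL: the global
realified category is `(∏_v 𝒟_v) × 𝒟_v` with `ℱ^⊢`-components the projections of the FIRST factor, so the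
automorphism `-1` of the second factor is a non-identity global component of an automorphism of a Θ-Hodge theater
lying over the identity of `†𝔇_>`. ([IUTchI] Cor 5.6 (i) p.154) [claim: Mochizuki2012, status: disputed] -/
theorem exists_fkit_not_rlfDetermined (l : ℕ) [Fact l.Prime] (hl : l ≠ 2) :
    ∃ FK : (toyKit l hl).FKit (MultKit.toy l hl),
      FK.ThToFBijOnGood ∧ FK.IsomFtoDBijective ∧ FK.AutTemperedBijective ∧
        ¬ FK.RlfDetermined ∧ ¬ FK.Cor56iKit := by
  let FK : (toyKit l hl).FKit (MultKit.toy l hl) :=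
    { FAmb := fun _ => Model.Obj l
      fModel := fun _ => Model.Obj.loc
      FmAmb := fun _ => Model.Obj l
      fmModel := fun _ => Model.Obj.loc
      toD := fun _ => 𝟭 _
      toD_model := fun _ => Iso.refl _
      toFm := fun _ => 𝟭 _
      toFm_model := fun _ => Iso.refl _
      -- the global realified data: the product over `𝕍` TIMES an extra copy invisible to `rlfFm`
      RlfAmb := (∀ _ : (toyKit l hl).V, Model.Obj l) × Model.Obj l
      rlfModel := (fun _ => Model.Obj.loc, Model.Obj.loc)
      rlfFm := fun v => CategoryTheory.Prod.fst _ _ ⋙ Pi.eval _ v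
      rlfOf := fun F => (F, Model.Obj.loc)
      rlfOfMap := fun φ => Iso.prod (Pi.isoMk φ) (Iso.refl _)
      rlfFm_rlfOf := fun _ _ => Iso.refl _
      ThAmb := fun _ => Model.Obj l
      thModel := fun _ => Model.Obj.loc
      thToF := fun _ => 𝟭 _
      thToF_model := fun _ => Iso.refl _
      toDm := fun _ => SingleObj.star _
      toDmMap := fun _ => 𝟙 _
      toDm_toFm := fun _ _ => ⟨𝟙 _⟩ }
  have h02 : FK.ThToFBijOnGood := fun v _ =>
    ⟨fun α β h => Iso.ext (congrArg Iso.hom h), fun ψ => ⟨ψ, Iso.ext rfl⟩⟩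
  have h53ii : FK.IsomFtoDBijective :=
    isomFtoDBijective_of_fullyFaithful fun v => Functor.FullyFaithful.id _
  have h53iv : FK.AutTemperedBijective := fun v _ =>
    ⟨fun α β h => Iso.ext (congrArg Iso.hom h), fun ψ => ⟨ψ, Iso.ext rfl⟩⟩
  -- a Θ-Hodge theater of the kit (all data = the models)
  let H : FK.ThetaHT :=
    { th := fun _ => Model.Obj.loc
      th_isModel := fun _ => ⟨Iso.refl _⟩
      rlf := (fun _ => Model.Obj.loc, Model.Obj.loc)
      rlf_isModel := ⟨Iso.refl _⟩
      rlf_fm := fun _ => Iso.refl _ }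
  -- the automorphism `-1 ∈ ℤˣ = Aut(𝒟_v)` of the invisible factor
  let neg : (Model.Obj.loc : Model.Obj l) ≅ Model.Obj.loc :=
    { hom := show ℤˣ from -1
      inv := show ℤˣ from -1
      hom_inv_id := show (-1 : ℤˣ) * (-1) = 1 by simp
      inv_hom_id := show (-1 : ℤˣ) * (-1) = 1 by simp }
  -- two global components compatible with the identity local isomorphisms
  let r₁ : H.rlf ≅ H.rlf := Iso.refl _
  let r₂ : H.rlf ≅ H.rlf := Iso.prod (Iso.refl _) neg
  have hr₁ : ThetaHT.RlfCompat H H (fun v => Iso.refl _) r₁ := fun v => rfl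
  have hr₂ : ThetaHT.RlfCompat H H (fun v => Iso.refl _) r₂ := fun v => rfl
  have hne : r₁ ≠ r₂ := by
    intro h
    have h2 : (r₁.hom).2 = (r₂.hom).2 := by rw [h]
    change (1 : ℤˣ) = -1 at h2
    exact absurd h2 (by decide)
  have hnot : ¬ FK.RlfDetermined := by
    intro hdet
    exact hne ((hdet H H fun v => Iso.refl _).unique hr₁ hr₂)
  exact ⟨FK, h02, h53ii, h53iv, hnot,
    fun hc => hnot ((cor56iKit_iff_rlfDetermined h02 h53ii h53iv).mp hc)⟩

/-- Hence the printed input of row L03 is load-bearing: over the kit, **Cor 5.6 (i) is NOT derivable from row L02 and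
Cor 5.3 (ii), (iv) alone** (there is a kit satisfying the three and violating `Cor56iKit`).
([IUTchI] Cor 5.6 (i) p.154) [claim: Mochizuki2012, status: disputed] -/
theorem not_forall_cor56iKit_of_cor53 (l : ℕ) [Fact l.Prime] (hl : l ≠ 2) :
    ¬ ∀ FK : (toyKit l hl).FKit (MultKit.toy l hl),
      FK.ThToFBijOnGood → FK.IsomFtoDBijective → FK.AutTemperedBijective → FK.Cor56iKit := by
  intro h
  obtain ⟨FK, h02, h53ii, h53iv, -, hc⟩ := exists_fkit_not_rlfDetermined l hl
  exact hc (h FK h02 h53ii h53iv)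

end FKit

end PMBaseKit

end Literature.IUT.HodgeTheaters
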